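import Summits.Langlands.Langlands.Theses.QuadraticWindow

/-!
# Birth skeleton (BC3) of the D5 piece `SatakeMatchingRigidity` of the split of `BeyondTheWindow` (stmt-Langlands-3202)

≥ 2 NAMED stubs `stub_*` (sorry) and the kernel-checked composition `SatakeMatchingRigidity_of : stubs → SatakeMatchingRigidity`
concluding the piece's statement VERBATIM (the piece is not yet a route decl: it is written out).  To be
published as `Lines/birth.lean` of the child item once the split of `BeyondTheWindow` lands.
-/

set_option linter.dupNamespace false
set_option linter.unusedVariables false

noncomputable section

namespace Summit.Langlands.Langlands.Cruxes.BeyondTheWindow.Birth.SatakeMatchingRigidity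

open scoped Classical
open Summit.Langlands.Langlands.Theses.QuadraticWindow
open Literature.NumberTheory.Automorphic Literature.NumberTheory.GaloisRepresentations
open NumberField IsDedekindDomain Filter Polynomial

/-- **stub 1 — Frobenius rigidity (THEOREM-grade: Chebotarev density + Brauer–Nesbitt + continuity):** an
IRREDUCIBLE `ρ` and any `ρ'` of the same dimension with equal Frobenius characteristic polynomials at all
but finitely many (jointly unramified) places are conjugate — the Frobenius classes are dense (Chebotarev),
characteristic polynomials are continuous, equal traces give isomorphic semisimplifications (Brauer–Nesbitt
in characteristic `0`), and a representation whose semisimplification is irreducible is irreducible.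
Serre 1968, Ch. I §2.3.  Not in Mathlib (no Chebotarev for `ℓ`-adic representations, no Brauer–Nesbitt for
profinite groups); the tree has the finite-image shadow `PatchingLemma.exists_conj_of_trace_eq`.
[cite: SerreAbelianLadic1968, Ch. I §2.3] -/
theorem stub_frobeniusRigidity : ∀ (F : Type) [Field F] [NumberField F] (ℓ : ℕ) [Fact ℓ.Prime] (n : ℕ) (ρ ρ' : Literature.NumberTheory.GaloisRepresentations.FramedGaloisRep F (PadicAlgCl ℓ) n), ρ.toGaloisRep.IsIrreducible → (∀ᶠ v : IsDedekindDomain.HeightOneSpectrum (NumberField.RingOfIntegers F) in Filter.cofinite, ∃ P : Polynomial (PadicAlgCl ℓ), ρ.IsUnramifiedAt v ∧ ρ'.IsUnramifiedAt v ∧ ρ.HasFrobCharpolyAt v P ∧ ρ'.HasFrobCharpolyAt v P) → IsConjugate ρ ρ' := by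
  sorry

/-- **stub 2 — compatibility of Satake-matched representations (CONJECTURE-grade):** `∀ F ∃ R`, every
semisimple `ρ` Satake-matched a.e. with an L-algebraic cuspidal `π` is irreducible, `R`-geometric and
locally–globally compatible with `π` at EVERY finite place — irreducibility of `ρ_π` (Ramakrishnan 2008;
open in general), LGC at `v ∤ ℓ` / `v ∣ ℓ` (Taylor–Yoshida, Caraiani 2014; Varma 2024 for the HLTT–Scholze
representations up to monodromy), de Rhamness at `ℓ`. [cite: Ramakrishnan2008] [cite: Caraiani2014] [cite: VarmaFMS2024] -/
theorem stub_compatibilityOfMatched : ∀ (F : Type) [Field F] [NumberField F], ∃ R : ReciprocityData F, ∀ (n : ℕ), 0 < n → ∀ (hcpt : Literature.NumberTheory.Automorphic.isCompact_glFiniteIntegralLevel n F) (π : Literature.NumberTheory.Automorphic.CuspidalAutomorphicRepData n F hcpt), π.1.IsLAlgebraic → ∀ (ℓ : ℕ) [Fact ℓ.Prime] (ι : PadicAlgCl ℓ ≃+* ℂ) (ρ : Literature.NumberTheory.GaloisRepresentations.FramedGaloisRep F (PadicAlgCl ℓ) n), ρ.toGaloisRep.IsSemisimple → (∀ᶠ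 v in Filter.cofinite, SatakeFrobCompatibleAt ι π.1 ρ v) → ρ.toGaloisRep.IsIrreducible ∧ IsGeometricFramed R ρ ∧ ∀ v : IsDedekindDomain.HeightOneSpectrum (NumberField.RingOfIntegers F), LocalGlobalCompatibleAt R ι π.1 ρ v := by
  sorry

/-- **Composition (real proof):** `R` and irreducibility / geometricity / compatibility from stub 2;
uniqueness from stub 1 — a `ρ'` corresponding to `π` is Satake-matched with `π` a.e., Satake parameters are
unique (Flath, tree `hasSatakeParamAt_unique_holds`), so `ρ` and `ρ'` have the same Frobenius
characteristic polynomial `arithFrobPolyOfSatake ι q_v 1 α_v` at all but finitely many places, and `ρ` is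
irreducible. [cite: BuzzardGeeLMS2014, Conj. 3.2.2] -/
theorem SatakeMatchingRigidity_of
    (h₁ : ∀ (F : Type) [Field F] [NumberField F] (ℓ : ℕ) [Fact ℓ.Prime] (n : ℕ) (ρ ρ' : Literature.NumberTheory.GaloisRepresentations.FramedGaloisRep F (PadicAlgCl ℓ) n), ρ.toGaloisRep.IsIrreducible → (∀ᶠ v : IsDedekindDomain.HeightOneSpectrum (NumberField.RingOfIntegers F) in Filter.cofinite, ∃ P : Polynomial (PadicAlgCl ℓ), ρ.IsUnramifiedAt v ∧ ρ'.IsUnramifiedAt v ∧ ρ.HasFrobCharpolyAt v P ∧ ρ'.HasFrobCharpolyAt v P) → IsConjugate ρ ρ')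
    (h₂ : ∀ (F : Type) [Field F] [NumberField F], ∃ R : ReciprocityData F, ∀ (n : ℕ), 0 < n → ∀ (hcpt : Literature.NumberTheory.Automorphic.isCompact_glFiniteIntegralLevel n F) (π : Literature.NumberTheory.Automorphic.CuspidalAutomorphicRepData n F hcpt), π.1.IsLAlgebraic → ∀ (ℓ : ℕ) [Fact ℓ.Prime] (ι : PadicAlgCl ℓ ≃+* ℂ) (ρ : Literature.NumberTheory.GaloisRepresentations.FramedGaloisRep F (PadicAlgCl ℓ) n), ρ.toGaloisRep.IsSemisimple → (∀ᶠ v in Filter.cofinite, SatakeFrobCompatibleAt ι π.1 ρ v) → ρ.toGaloisRep.IsIrreducible ∧ IsGeometricFramed R ρ ∧ ∀ v : IsDedekindDomain.HeightOneSpectrum (NumberField.RingOfIntegers F), LocalGlobalCompatibleAt R ι π.1 ρ v) :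
    ∀ (F : Type) [Field F] [NumberField F], ∃ R : ReciprocityData F, ∀ (n : ℕ), 0 < n → ∀ (hcpt : Literature.NumberTheory.Automorphic.isCompact_glFiniteIntegralLevel n F) (π : Literature.NumberTheory.Automorphic.CuspidalAutomorphicRepData n F hcpt), π.1.IsLAlgebraic → ∀ (ℓ : ℕ) [Fact ℓ.Prime] (ι : PadicAlgCl ℓ ≃+* ℂ) (ρ : Literature.NumberTheory.GaloisRepresentations.FramedGaloisRep F (PadicAlgCl ℓ) n), ρ.toGaloisRep.IsSemisimple → (∀ᶠ v in Filter.cofinite, SatakeFrobCompatibleAt ι π.1 ρ v) → ρ.toGaloisRep.IsIrreducible ∧ IsGeometricFramed R ρ ∧ (∀ v : IsDedekindDomain.HeightOneSpectrum (NumberField.RingOfIntegers F), LocalGlobalCompatibleAt R ι π.1 ρ v) ∧ ∀ ρ' : Literature.NumberTheory.GaloisRepresentations.FramedGaloisRep F (PadicAlgCl ℓ) n, Corresponds R ι π.1 ρ' → IsConjugate ρ ρ' := by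
  intro F _ _
  obtain ⟨R, hR⟩ := h₂ F
  refine ⟨R, fun n hn hcpt π hL ℓ _ ι ρ hss hsat => ?_⟩
  obtain ⟨hirr, hgeo, hlgc⟩ := hR n hn hcpt π hL ℓ ι ρ hss hsat
  refine ⟨hirr, hgeo, hlgc, fun ρ' hρ' => h₁ F ℓ n ρ ρ' hirr ?_⟩
  filter_upwards [hsat, hρ'.1] with v ⟨α, hα, hur, hch⟩ ⟨α', hα', hur', hch'⟩
  obtain rfl : α = α' := π.1.hasSatakeParamAt_unique_holds hα hα'
  exact ⟨_, hur, hur', hch, hch'⟩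

end Summit.Langlands.Langlands.Cruxes.BeyondTheWindow.Birth.SatakeMatchingRigidity

end
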